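import Mathlib.LinearAlgebra.Matrix.Rank
import Mathlib.LinearAlgebra.Matrix.NonsingularInverse
import Mathlib.LinearAlgebra.Matrix.ToLin
import Mathlib.LinearAlgebra.FiniteDimensional.Lemmas
import HarnessLib

/-!
# Ventures/CertifiedQuantumChemistry — Rows/CommutingCoverRank.lean: the RANK of a matrix that
# commutes with a complete family of orthogonal idempotents is the SUM of the ranks of its reduced
# blocks (the soundness of the symmetry-adapted twin checker's summed rank words)

HONEST FRAMING (verbatim): certified bounds for a stated model Hamiltonian in a stated basis; not a
claim about the real molecule beyond that model. Nothing here asserts a value, a row or a claim node;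
the `X_∞` programmes this lemma serves are auxiliary limit programmes, never CERTIFIED rows.

Seat rdm-B (gen 32), zero compute; theorems only (no `def`). Companion of
`Rows/InvariantCoverPSD.lean` (gen 30: `B ⪰ 0 ⟺` every reduced block `⪰ 0`) and
`Rows/ExactLDLRank.lean` (gen 31: the printed `rank` of one exact `LDLᵀ` pass IS `Matrix.rank`).
The symmetry-adapted twin checker `pub-qchem-rdmb/tools/x12-g28/x12e/check_enclosure_sym.py`
— named CO-CHECKER at `L = 14` by RULE ENC-14 (1)(c) option (ii) — prints, for every PSD block `B`
of a certificate, ONE rank word obtained by SUMMING the `LDLᵀ` ranks of the reduced blocks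
`V_aᵀ B V_a` over the isotypic pieces `a` of the block's signed-permutation symmetry (a piece of a
two-dimensional type is tested once and counted twice, by the transport lemma
`InvariantCover.reduced_block_eq_of_commute`). The A≡B test against the record checker (plain
`LDLᵀ` on the whole block; `ab-files/v59/AB_TABLE.md`) compares exactly these words. This file types
the linear-algebra fact that makes the summed word equal to `rank B`:

* `CommutingCover.finrank_range_eq_sum` — linear maps: if `f` commutes with endomorphisms `e_a`
  that SUM TO THE IDENTITY and are PAIRWISE ORTHOGONAL (`e_a ∘ e_b = 0`, `a ≠ b`; idempotency
  follows), then `dim range f = Σ_a dim range (f ∘ e_a)`. Proof: `range f = ⨆_a range (f ∘ e_a)`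
  (because `f = Σ_a f ∘ e_a`), and the pieces are in direct sum: `range (f ∘ e_a) ≤ range e_a` lies
  in `ker e_b` for `b ≠ a` while `e_b` is the identity on `range e_b` — a finset induction with
  `dim (p ⊔ q) + dim (p ⊓ q) = dim p + dim q`.
* `CommutingCover.rank_eq_sum_rank_mul` — matrices: `rank B = Σ_a rank (B E_a)` for a commuting
  cover `Σ_a E_a = 1`, `E_a E_b = 0` (`a ≠ b`), `B E_a = E_a B`.
* `CommutingCover.rank_mul_eq_rank_sandwich` / `rank_transpose_mul_mul_eq` — ONE piece in frames:
  if `E = V W` with `W V = 1` then `rank (B E) = rank (W B V)`; and if moreover the Gram matrix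
  `Vᵀ V` is invertible then `rank (Vᵀ B V) = rank (B E)` — the reduced block the checker factors
  is `Vᵀ B V` with `V` = an independent set of columns of the (rational) isotypic projector.
* `CommutingCover.rank_eq_sum_rank_reduced_blocks` — the checker's word: under the cover
  hypotheses, `rank B = Σ_a rank (V_aᵀ B V_a)`; `…_of_injective` discharges the Gram hypothesis
  over a linearly ordered field (`rank (Vᵀ V) = rank V`, Mathlib), which is the checker's case
  (`ℚ`; its `ℚ(√2)` branch is a real quadratic field, ordered likewise).

How the checker instantiates it (words, not Lean): per block it VERIFIES EXACTLY that the rational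
isotypic projectors `P_a` satisfy `Σ_a P_a = |G|·1`, `P_a P_b = 0` (`a ≠ b`) and commute with `B`
(`E_a := P_a / |G|`), and takes `V_a` = a maximal independent set of columns of `P_a`
(so `range E_a = range V_a`, `E_a = V_a W_a` with `W_a V_a = 1`). Scalars: any field for the cover
lemmas; a linearly ordered field for the Gram discharge. Everything is PROVED (0 sorry). References
(docstring-only): block-diagonalisation in symmetry reduction of semidefinite programmes,
K. Gatermann, P. A. Parrilo, J. Pure Appl. Algebra 192 (2004) 95, §3; the rank additivity over a
direct-sum decomposition preserved by an endomorphism is folklore linear algebra.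
-/

namespace Summit.Ventures.CertifiedQuantumChemistry

open Matrix Module

namespace CommutingCover

section LinearMaps

variable {𝕜 : Type*} [Field 𝕜] {M : Type*} [AddCommGroup M] [Module 𝕜 M]
variable {ι : Type*}

/-- For `a ≠ b`, the piece `range (f ∘ e_a)` of a commuting cover lies in `ker e_b`. [folklore] -/
theorem range_comp_le_ker {f : M →ₗ[𝕜] M} {e : ι → M →ₗ[𝕜] M}
    (horth : ∀ a b, a ≠ b → e a ∘ₗ e b = 0) (hc : ∀ a, f ∘ₗ e a = e a ∘ₗ f) {a b : ι} (hab : a ≠ b) :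
    LinearMap.range (f ∘ₗ e a) ≤ LinearMap.ker (e b) := by
  rw [LinearMap.range_le_ker_iff, ← LinearMap.comp_assoc, ← hc b, LinearMap.comp_assoc,
    horth b a (Ne.symm hab), LinearMap.comp_zero]

/-- The piece `range (f ∘ e_a)` lies in `range e_a` (commutation). [folklore] -/
theorem range_comp_le_range {f : M →ₗ[𝕜] M} {e : ι → M →ₗ[𝕜] M}
    (hc : ∀ a, f ∘ₗ e a = e a ∘ₗ f) (a : ι) :
    LinearMap.range (f ∘ₗ e a) ≤ LinearMap.range (e a) := by
  rw [hc a]; exact LinearMap.range_comp_le_range f (e a)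

variable [Fintype ι]

/-- In a cover `Σ_a e_a = id` with `e_a ∘ e_b = 0` for `a ≠ b`, every `e_a` is idempotent. [folklore] -/
theorem idempotent_of_cover {e : ι → M →ₗ[𝕜] M} (hsum : ∑ a, e a = LinearMap.id)
    (horth : ∀ a b, a ≠ b → e a ∘ₗ e b = 0) (a : ι) : e a ∘ₗ e a = e a := by
  have h : e a ∘ₗ (∑ b, e b) = ∑ b, e a ∘ₗ e b := by
    ext x; simp [LinearMap.sum_apply, map_sum]
  rw [hsum, LinearMap.comp_id,
    Finset.sum_eq_single a (fun b _ hb => horth a b (Ne.symm hb)) (by simp)] at h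
  exact h.symm

/-- `e_b` is the identity on its own range (idempotency). [folklore] -/
theorem apply_eq_self_of_mem_range {e : ι → M →ₗ[𝕜] M} (hsum : ∑ a, e a = LinearMap.id)
    (horth : ∀ a b, a ≠ b → e a ∘ₗ e b = 0) (b : ι) {x : M} (hx : x ∈ LinearMap.range (e b)) :
    e b x = x := by
  obtain ⟨y, rfl⟩ := hx
  have := idempotent_of_cover hsum horth b
  exact congrArg (fun g : M →ₗ[𝕜] M => g y) this

/-- `range f` is the supremum of the pieces `range (f ∘ e_a)` of a cover `Σ_a e_a = id`. [folklore] -/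
theorem range_eq_biSup_range_comp {f : M →ₗ[𝕜] M} {e : ι → M →ₗ[𝕜] M}
    (hsum : ∑ a, e a = LinearMap.id) :
    LinearMap.range f = ⨆ a ∈ (Finset.univ : Finset ι), LinearMap.range (f ∘ₗ e a) := by
  apply le_antisymm
  · rintro _ ⟨x, rfl⟩
    have hx : f x = ∑ a, (f ∘ₗ e a) x := by
      have := congrArg (fun g : M →ₗ[𝕜] M => f (g x)) hsum
      simpa [LinearMap.sum_apply, map_sum] using this.symm
    rw [hx]
    exact Submodule.sum_mem _ fun a _ =>
      (Submodule.mem_iSup_of_mem a (Submodule.mem_iSup_of_mem (Finset.mem_univ a)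
        (LinearMap.mem_range_self _ x)))
  · exact iSup₂_le fun a _ => LinearMap.range_comp_le_range (e a) f

variable [FiniteDimensional 𝕜 M]

/-- Finset form of the rank additivity: `dim (⨆_{a ∈ s} range (f ∘ e_a)) = Σ_{a ∈ s} dim range (f ∘ e_a)`
for a commuting orthogonal cover. [folklore] -/
theorem finrank_biSup_range_eq_sum {f : M →ₗ[𝕜] M} {e : ι → M →ₗ[𝕜] M}
    (hsum : ∑ a, e a = LinearMap.id) (horth : ∀ a b, a ≠ b → e a ∘ₗ e b = 0)
    (hc : ∀ a, f ∘ₗ e a = e a ∘ₗ f) (s : Finset ι) :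
    finrank 𝕜 ↥(⨆ a ∈ s, LinearMap.range (f ∘ₗ e a)) =
      ∑ a ∈ s, finrank 𝕜 ↥(LinearMap.range (f ∘ₗ e a)) := by
  classical
  induction s using Finset.induction_on with
  | empty => simp
  | insert b s hb ih =>
    rw [Finset.iSup_insert, Finset.sum_insert hb, ← ih]
    have hinf : LinearMap.range (f ∘ₗ e b) ⊓ (⨆ a ∈ s, LinearMap.range (f ∘ₗ e a)) = ⊥ := by
      rw [Submodule.eq_bot_iff]
      intro x hx
      obtain ⟨hx1, hx2⟩ := Submodule.mem_inf.mp hx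
      have hle : (⨆ a ∈ s, LinearMap.range (f ∘ₗ e a)) ≤ LinearMap.ker (e b) :=
        iSup₂_le fun a ha => range_comp_le_ker horth hc (fun h => hb (h ▸ ha))
      have h0 : e b x = 0 := LinearMap.mem_ker.mp (hle hx2)
      have h1 : e b x = x :=
        apply_eq_self_of_mem_range hsum horth b (range_comp_le_range hc b hx1)
      rw [← h1, h0]
    have := Submodule.finrank_sup_add_finrank_inf_eq (LinearMap.range (f ∘ₗ e b))
      (⨆ a ∈ s, LinearMap.range (f ∘ₗ e a))
    rw [hinf, finrank_bot, add_zero] at this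
    exact this

/-- **Rank additivity over a commuting orthogonal cover (linear maps).** If `Σ_a e_a = id`,
`e_a ∘ e_b = 0` for `a ≠ b`, and `f ∘ e_a = e_a ∘ f` for all `a`, then
`dim range f = Σ_a dim range (f ∘ e_a)`. [folklore] -/
theorem finrank_range_eq_sum {f : M →ₗ[𝕜] M} {e : ι → M →ₗ[𝕜] M}
    (hsum : ∑ a, e a = LinearMap.id) (horth : ∀ a b, a ≠ b → e a ∘ₗ e b = 0)
    (hc : ∀ a, f ∘ₗ e a = e a ∘ₗ f) :
    finrank 𝕜 ↥(LinearMap.range f) = ∑ a, finrank 𝕜 ↥(LinearMap.range (f ∘ₗ e a)) := by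
  rw [range_eq_biSup_range_comp hsum, finrank_biSup_range_eq_sum hsum horth hc]

end LinearMaps

section Matrices

variable {𝕜 : Type*} [Field 𝕜] {n ι : Type*} [Fintype n] [Fintype ι]

/-- `Matrix.rank` is the dimension of the range of `Matrix.toLin'`. [folklore] -/
theorem rank_eq_finrank_range_toLin' [DecidableEq n] {m : Type*} [Fintype m] (A : Matrix m n 𝕜) :
    A.rank = finrank 𝕜 ↥(LinearMap.range (Matrix.toLin' A)) := by
  rw [Matrix.toLin'_apply']; rfl

/-- **Rank additivity over a commuting cover (matrices).** If `Σ_a E_a = 1`, `E_a E_b = 0` for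
`a ≠ b` and `B E_a = E_a B` for all `a`, then `rank B = Σ_a rank (B E_a)`. [folklore] -/
theorem rank_eq_sum_rank_mul [DecidableEq n] (B : Matrix n n 𝕜) (E : ι → Matrix n n 𝕜)
    (hsum : ∑ a, E a = 1) (horth : ∀ a b, a ≠ b → E a * E b = 0) (hc : ∀ a, B * E a = E a * B) :
    B.rank = ∑ a, (B * E a).rank := by
  have hsum' : ∑ a, Matrix.toLin' (E a) = LinearMap.id := by
    rw [← Matrix.toLin'_one, ← hsum]; exact (map_sum Matrix.toLin' E Finset.univ).symm
  have horth' : ∀ a b, a ≠ b → Matrix.toLin' (E a) ∘ₗ Matrix.toLin' (E b) = 0 := fun a b hab => by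
    rw [← Matrix.toLin'_mul, horth a b hab, map_zero]
  have hc' : ∀ a, Matrix.toLin' B ∘ₗ Matrix.toLin' (E a) = Matrix.toLin' (E a) ∘ₗ Matrix.toLin' B :=
    fun a => by rw [← Matrix.toLin'_mul, ← Matrix.toLin'_mul, hc a]
  rw [rank_eq_finrank_range_toLin', finrank_range_eq_sum hsum' horth' hc']
  refine Finset.sum_congr rfl fun a _ => ?_
  rw [rank_eq_finrank_range_toLin', Matrix.toLin'_mul]

variable {k : Type*} [Fintype k] [DecidableEq k]

/-- A matrix with a LEFT inverse preserves rank on the left: `W V = 1 ⟹ rank (V C) = rank C`. [folklore] -/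
theorem rank_mul_eq_right_of_left_inverse {p : Type*} [Fintype p] (V : Matrix n k 𝕜) (W : Matrix k n 𝕜)
    (hWV : W * V = 1) (C : Matrix k p 𝕜) : (V * C).rank = C.rank := by
  apply le_antisymm (Matrix.rank_mul_le_right V C)
  calc C.rank = (W * (V * C)).rank := by rw [← Matrix.mul_assoc, hWV, Matrix.one_mul]
    _ ≤ (V * C).rank := Matrix.rank_mul_le_right W (V * C)

/-- A matrix with a RIGHT inverse preserves rank on the right: `W V = 1 ⟹ rank (C W) = rank C`. [folklore] -/
theorem rank_mul_eq_left_of_right_inverse {p : Type*} [Fintype p] (V : Matrix n k 𝕜) (W : Matrix k n 𝕜)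
    (hWV : W * V = 1) (C : Matrix p k 𝕜) : (C * W).rank = C.rank := by
  apply le_antisymm (Matrix.rank_mul_le_left C W)
  calc C.rank = (C * W * V).rank := by rw [Matrix.mul_assoc, hWV, Matrix.mul_one]
    _ ≤ (C * W).rank := Matrix.rank_mul_le_left (C * W) V

/-- **One piece in frames.** If `E = V W` with `W V = 1` (so `E` is an idempotent with
`range E = range V`) and `B` commutes with `E`, then `rank (B E) = rank (W B V)`: the `k × k`
compression carries the whole rank of the piece. [folklore] -/
theorem rank_mul_eq_rank_sandwich (B : Matrix n n 𝕜) (V : Matrix n k 𝕜) (W : Matrix k n 𝕜)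
    (hWV : W * V = 1) (hc : B * (V * W) = (V * W) * B) : (B * (V * W)).rank = (W * B * V).rank := by
  have hE : B * (V * W) = V * (W * B * V) * W := by
    calc B * (V * W) = B * (V * (W * V) * W) := by rw [hWV, Matrix.mul_one]
      _ = (B * (V * W)) * (V * W) := by simp only [Matrix.mul_assoc]
      _ = (V * W) * B * (V * W) := by rw [hc]
      _ = V * (W * B * V) * W := by simp only [Matrix.mul_assoc]
  rw [hE, rank_mul_eq_left_of_right_inverse V W hWV, rank_mul_eq_right_of_left_inverse V W hWV]

/-- Commutation with `E = V W`, `W V = 1`, makes `range V` invariant: `B V = V (W B V)`. [folklore] -/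
theorem mul_eq_mul_sandwich (B : Matrix n n 𝕜) (V : Matrix n k 𝕜) (W : Matrix k n 𝕜)
    (hWV : W * V = 1) (hc : B * (V * W) = (V * W) * B) : B * V = V * (W * B * V) := by
  calc B * V = B * (V * (W * V)) := by rw [hWV, Matrix.mul_one]
    _ = (B * (V * W)) * V := by simp only [Matrix.mul_assoc]
    _ = V * (W * B * V) := by rw [hc]; simp only [Matrix.mul_assoc]

/-- **The reduced block of the checker.** If the Gram matrix `Vᵀ V` is invertible and
`B V = V C` (the column span of `V` is `B`-invariant), then `rank (Vᵀ B V) = rank C = rank (B V)`.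
[folklore] -/
theorem rank_transpose_mul_mul_eq (B : Matrix n n 𝕜) (V : Matrix n k 𝕜) (hG : IsUnit (Vᵀ * V))
    (C : Matrix k k 𝕜) (hBV : B * V = V * C) : (Vᵀ * B * V).rank = (B * V).rank := by
  have hdet : IsUnit (Vᵀ * V).det := (Matrix.isUnit_iff_isUnit_det _).mp hG
  obtain ⟨W, hWV⟩ : ∃ W : Matrix k n 𝕜, W * V = 1 :=
    ⟨(Vᵀ * V)⁻¹ * Vᵀ, by rw [Matrix.mul_assoc, Matrix.nonsing_inv_mul _ hdet]⟩
  rw [Matrix.mul_assoc, hBV, ← Matrix.mul_assoc, Matrix.rank_mul_eq_right_of_isUnit_det _ _ hdet,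
    rank_mul_eq_right_of_left_inverse V W hWV]

variable {κ : ι → Type*} [∀ a, Fintype (κ a)] [∀ a, DecidableEq (κ a)]

/-- **The twin checker's summed rank word.** Let `B` commute with a cover `E_a = V_a W_a`
(`W_a V_a = 1`, `Σ_a E_a = 1`, `E_a E_b = 0` for `a ≠ b`) whose frames have invertible Gram
matrices `V_aᵀ V_a`. Then `rank B = Σ_a rank (V_aᵀ B V_a)`. [folklore] -/
theorem rank_eq_sum_rank_reduced_blocks [DecidableEq n] (B : Matrix n n 𝕜)
    (V : (a : ι) → Matrix n (κ a) 𝕜) (W : (a : ι) → Matrix (κ a) n 𝕜) (hWV : ∀ a, W a * V a = 1) (hsum : ∑ a, V a * W a = 1)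
    (horth : ∀ a b, a ≠ b → (V a * W a) * (V b * W b) = 0)
    (hc : ∀ a, B * (V a * W a) = (V a * W a) * B) (hG : ∀ a, IsUnit ((V a)ᵀ * V a)) :
    B.rank = ∑ a, ((V a)ᵀ * B * V a).rank := by
  rw [rank_eq_sum_rank_mul B (fun a => V a * W a) hsum horth hc]
  refine Finset.sum_congr rfl fun a _ => ?_
  rw [rank_mul_eq_rank_sandwich B (V a) (W a) (hWV a) (hc a),
    rank_transpose_mul_mul_eq B (V a) (hG a) (W a * B * V a) (mul_eq_mul_sandwich B (V a) (W a) (hWV a) (hc a)),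
    mul_eq_mul_sandwich B (V a) (W a) (hWV a) (hc a), rank_mul_eq_right_of_left_inverse (V a) (W a) (hWV a)]

end Matrices

section Ordered

variable {𝕜 : Type*} [Field 𝕜] [LinearOrder 𝕜] [IsStrictOrderedRing 𝕜]
variable {n k : Type*} [Fintype n] [Fintype k] [DecidableEq k]

/-- Over a linearly ordered field a frame with a left inverse has an invertible Gram matrix
(`rank (Vᵀ V) = rank V = k`). [folklore] -/
theorem isUnit_transpose_mul_self_of_left_inverse (V : Matrix n k 𝕜) (W : Matrix k n 𝕜)
    (hWV : W * V = 1) : IsUnit (Vᵀ * V) := by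
  have hrk : (Vᵀ * V).rank = Fintype.card k := by
    rw [Matrix.rank_transpose_mul_self]
    apply le_antisymm (Matrix.rank_le_card_width V)
    calc Fintype.card k = (1 : Matrix k k 𝕜).rank := (Matrix.rank_one).symm
      _ = (W * V).rank := by rw [hWV]
      _ ≤ V.rank := Matrix.rank_mul_le_right W V
  have hsurj : Function.Surjective (Vᵀ * V).mulVec := by
    have htop : LinearMap.range (Matrix.toLin' (Vᵀ * V)) = ⊤ := by
      apply Submodule.eq_top_of_finrank_eq
      rw [← rank_eq_finrank_range_toLin', hrk, finrank_pi]
    exact LinearMap.range_eq_top.mp htop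
  exact Matrix.mulVec_surjective_iff_isUnit.mp hsurj

variable {ι : Type*} [Fintype ι] {κ : ι → Type*} [∀ a, Fintype (κ a)] [∀ a, DecidableEq (κ a)]

/-- **The twin checker's summed rank word, ordered-field form** (the checker's case, `ℚ`): the
Gram hypothesis of `rank_eq_sum_rank_reduced_blocks` is automatic. [folklore] -/
theorem rank_eq_sum_rank_reduced_blocks_of_ordered [DecidableEq n] (B : Matrix n n 𝕜)
    (V : (a : ι) → Matrix n (κ a) 𝕜) (W : (a : ι) → Matrix (κ a) n 𝕜) (hWV : ∀ a, W a * V a = 1)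
    (hsum : ∑ a, V a * W a = 1) (horth : ∀ a b, a ≠ b → (V a * W a) * (V b * W b) = 0)
    (hc : ∀ a, B * (V a * W a) = (V a * W a) * B) :
    B.rank = ∑ a, ((V a)ᵀ * B * V a).rank :=
  rank_eq_sum_rank_reduced_blocks B V W hWV hsum horth hc
    fun a => isUnit_transpose_mul_self_of_left_inverse (V a) (W a) (hWV a)

end Ordered

end CommutingCover

end Summit.Ventures.CertifiedQuantumChemistry
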